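import Mathlib
import Literature.Analysis.FluidPDE.VectorCalculus
import Summits.NavierStokesRegularity.NavierStokesRegularity.Theorems.FilamentSkeletonRssClause13REdgeMeasureModel
import Summits.NavierStokesRegularity.NavierStokesRegularity.Theorems.FilamentSkeletonRssClause13RAdjointModelExistence

/-!
# Clause 13-R, STUB R at MODEL level: the annihilating EDGE MEASURE exists for every pair of edge atoms
# (punctured edge-measure annihilation + census item (R-c′-E); crux `Clause13RNearStraightL`, stmt-NavierStokesRegularity-23612; line `rate_bordered_split`,
# STUB R `stub_rateRow13RFlat`)

Route `FilamentSkeletonRss`, Variant A1R.  `…Clause13REdgeMeasureModel.edgeMeasure_annihilates` (p829163, hand fsrs-16-g0) shows: IF a density `φ ∈ C¹(ℝ)` solves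
ON THE WHOLE BALL `S = [a, b]` the model adjoint equation sourced by the edge kernels of two atoms `e₊` (at `b`), `e₋` (at `a`), then the edge measure
`e₊δ_b + e₋δ_a + φ dσ` annihilates the forward MODEL operator `L` on every clamped `C²` field.  The density delivered by the existence theory
(`…Clause13RAdjointModelExistence.exists_model_adjoint_punctured_solution`, p837535: Fredholm alternative over the waist-regular local solution operator) is
continuous on `S` but differentiable only on `S ∖ {c}` (`c` the stagnation point of the slip) — the natural class of `…Clause13RAdjointPunctured*`.
THIS FILE (def-free):
* `integral_transport_pairing_punctured` — transport by parts `∫⟪φ, −wY′⟫ = ∫⟪w′φ + ψ, Y⟫` for a CONTINUOUS `φ` differentiable off `c` with `wφ′ = ψ`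
  continuous (FTC on `[a, c]` and `[c, b]` separately; no condition at `c` beyond continuity);
* `edgeMeasure_annihilates_punctured` — p829163 with the density hypotheses weakened to «`φ` continuous, differentiable on `(a, b) ∖ {c}`, equation on
  `(a, b) ∖ {c}`» (the transport coefficient `wφ′` is read off the equation as a continuous function);
* `exists_annihilating_edgeMeasure` — **for EVERY pair of atoms `(e₊, e₋)` there is a continuous density `φ` such that `e₊δ_b + e₋δ_a + φ dσ` annihilates
  `LY` for all `C²` fields `Y` vanishing off `S`**: the model-level (C⁰)*-cokernel of the linearised operator on clamped fields CONTAINS the full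
  six-parameter edge family (and, by p828845/p830801/p832184, nothing else) — the model content of «the rate row of 13-R is pure edge information»,
  now with existence.  What remains for STUB R is clause transfer (R-c″) and the pairing floor / Γ-uniformity (R-S1).  [folklore]
Hand `leafhand-ns-filamentskeletonrs-25-g0` (LAND-ONLY); `--supports stmt-NavierStokesRegularity-23612` helper, def-free.  HONEST FRAMING: duality bookkeeping for the
MODEL of a HYPOTHETICAL filament skeleton on the NEGATIVE side of a MODEL blow-up route; STUB R is NOT proved here and nothing in this file bears on Navier–Stokes
regularity or blow-up.
-/

noncomputable section

open MeasureTheory Filter Topology Set intervalIntegral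
open scoped RealInnerProductSpace InnerProductSpace
open Literature.Analysis.FluidPDE
open Summit.NavierStokesRegularity.NavierStokesRegularity.Theorems.Clause13REdgeMeasureModel
  (inner_cross_transpose clamped_endpoints model_forward_at_clamped setIntegral_inner_nonlocal_swap)
open Summit.NavierStokesRegularity.NavierStokesRegularity.Theorems.Clause13RAdjointModelExistence (exists_model_adjoint_punctured_solution)

namespace Summit.NavierStokesRegularity.NavierStokesRegularity.Theorems.Clause13REdgeMeasurePunctured
set_option linter.dupNamespace false

/-! ## §1 Transport by parts for a punctured density -/

/-- **Transport by parts on a clamped field, punctured density**: `φ` continuous, differentiable on `(a, b) ∖ {c}` with `w φ′ = ψ` there, `ψ` continuous;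
`Y ∈ C¹` with `Y a = Y b = 0`.  Then `∫_a^b ⟪φ, −w•Y′⟫ = ∫_a^b ⟪w′•φ + ψ, Y⟫`. [folklore] -/
theorem integral_transport_pairing_punctured {a b c : ℝ} (hac : a < c) (hcb : c < b) {w w' : ℝ → ℝ}
    {φ φ' ψ Y Y' : ℝ → EuclideanSpace ℝ (Fin 3)}
    (hw : ∀ σ, HasDerivAt w (w' σ) σ) (hw'c : Continuous w') (hφc : Continuous φ)
    (hφ : ∀ σ ∈ Ioo a b, σ ≠ c → HasDerivAt φ (φ' σ) σ) (hψc : Continuous ψ)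
    (hψ : ∀ σ ∈ Ioo a b, σ ≠ c → w σ • φ' σ = ψ σ)
    (hYd : ∀ σ, HasDerivAt Y (Y' σ) σ) (hY'c : Continuous Y') (hYa : Y a = 0) (hYb : Y b = 0) :
    ∫ σ in a..b, ⟪φ σ, -(w σ • Y' σ)⟫ = ∫ σ in a..b, ⟪w' σ • φ σ + ψ σ, Y σ⟫ := by
  have hwc : Continuous w := continuous_iff_continuousAt.2 fun σ => (hw σ).continuousAt
  have hYc : Continuous Y := continuous_iff_continuousAt.2 fun σ => (hYd σ).continuousAt
  set F : ℝ → ℝ := fun σ => w σ * ⟪φ σ, Y σ⟫ with hF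
  set F' : ℝ → ℝ := fun σ => w' σ * ⟪φ σ, Y σ⟫ + (⟪ψ σ, Y σ⟫ + w σ * ⟪φ σ, Y' σ⟫) with hF'
  have hFc : Continuous F := hwc.mul (hφc.inner hYc)
  have hF'c : Continuous F' := (hw'c.mul (hφc.inner hYc)).add ((hψc.inner hYc).add (hwc.mul (hφc.inner hY'c)))
  have hderiv : ∀ σ ∈ Ioo a b, σ ≠ c → HasDerivAt F (F' σ) σ := by
    intro σ hσ hσc
    have hi : HasDerivAt (fun σ => ⟪φ σ, Y σ⟫) (⟪φ σ, Y' σ⟫ + ⟪φ' σ, Y σ⟫) σ := (hφ σ hσ hσc).inner ℝ (hYd σ)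
    have h := (hw σ).mul hi
    refine h.congr_deriv ?_
    have hψσ : w σ * ⟪φ' σ, Y σ⟫ = ⟪ψ σ, Y σ⟫ := by rw [← hψ σ hσ hσc, inner_smul_left, conj_trivial]
    simp only [hF']
    rw [← hψσ]; ring
  have hFTC1 : ∫ σ in a..c, F' σ = F c - F a :=
    integral_eq_sub_of_hasDerivAt_of_le hac.le hFc.continuousOn
      (fun x hx => hderiv x ⟨hx.1, hx.2.trans hcb⟩ (ne_of_lt hx.2)) (hF'c.intervalIntegrable _ _)
  have hFTC2 : ∫ σ in c..b, F' σ = F b - F c :=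
    integral_eq_sub_of_hasDerivAt_of_le hcb.le hFc.continuousOn
      (fun x hx => hderiv x ⟨hac.trans hx.1, hx.2⟩ (ne_of_gt hx.1)) (hF'c.intervalIntegrable _ _)
  have hFTC : ∫ σ in a..b, F' σ = 0 := by
    rw [← integral_add_adjacent_intervals (hF'c.intervalIntegrable a c) (hF'c.intervalIntegrable c b), hFTC1, hFTC2]
    simp only [hF, hYa, hYb, inner_zero_right, mul_zero]
    ring
  have h1 : ∫ σ in a..b, ⟪φ σ, -(w σ • Y' σ)⟫ = ∫ σ in a..b, -(w σ * ⟪φ σ, Y' σ⟫) := by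
    refine intervalIntegral.integral_congr fun σ _ => ?_
    simp only [inner_neg_right, inner_smul_right]
  have h2 : ∫ σ in a..b, ⟪w' σ • φ σ + ψ σ, Y σ⟫ = ∫ σ in a..b, (w' σ * ⟪φ σ, Y σ⟫ + ⟪ψ σ, Y σ⟫) := by
    refine intervalIntegral.integral_congr fun σ _ => ?_
    simp only [inner_add_left, inner_smul_left, conj_trivial]
  rw [h1, h2]
  have hi1 : IntervalIntegrable (fun σ => -(w σ * ⟪φ σ, Y' σ⟫)) volume a b :=
    (hwc.mul (hφc.inner hY'c)).neg.intervalIntegrable _ _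
  have hi2 : IntervalIntegrable (fun σ => w' σ * ⟪φ σ, Y σ⟫ + ⟪ψ σ, Y σ⟫) volume a b :=
    ((hw'c.mul (hφc.inner hYc)).add (hψc.inner hYc)).intervalIntegrable _ _
  have hsum : (∫ σ in a..b, (w' σ * ⟪φ σ, Y σ⟫ + ⟪ψ σ, Y σ⟫)) - ∫ σ in a..b, -(w σ * ⟪φ σ, Y' σ⟫) = 0 := by
    rw [← intervalIntegral.integral_sub hi2 hi1, ← hFTC]
    refine intervalIntegral.integral_congr fun σ _ => ?_
    simp only [hF']
    ring
  linarith

/-! ## §2 Edge-measure annihilation for a punctured density -/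

/-- **EDGE MEASURE ANNIHILATION, punctured density.**  As `…Clause13REdgeMeasureModel.edgeMeasure_annihilates`, but the density `φ` is only assumed
CONTINUOUS, differentiable on `(a, b) ∖ {c}` (`a < c < b`), and to solve the edge-sourced model adjoint equation on `(a, b) ∖ {c}`.  Then for every `C²`
field `Y` vanishing off `[a, b]`: `∫_a^b ⟪φ, LY⟫ + ⟪e₊, (LY)(b)⟫ + ⟪e₋, (LY)(a)⟫ = 0`. [folklore] -/
theorem edgeMeasure_annihilates_punctured {a b c cst α : ℝ} (hac : a < c) (hcb : c < b) {k m w w' : ℝ → ℝ}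
    {φ φ' : ℝ → EuclideanSpace ℝ (Fin 3)} {d e ep em : EuclideanSpace ℝ (Fin 3)}
    (hk : Continuous k) (hkev : ∀ s, k (-s) = k s) (hm : Continuous m)
    (hw : ∀ σ, HasDerivAt w (w' σ) σ) (hw'c : Continuous w') (hφc : Continuous φ)
    (hφ : ∀ σ ∈ Ioo a b, σ ≠ c → HasDerivAt φ (φ' σ) σ)
    (hsol : ∀ σ ∈ Ioo a b, σ ≠ c →
      cst • (m σ • cross (φ σ) d - ∫ τ in Icc a b, k (τ - σ) • cross (φ τ) d)
        + (1 / 2 : ℝ) • φ σ + α • cross e (φ σ) + w' σ • φ σ + w σ • φ' σ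
        = cst • (k (σ - b) • cross ep d + k (σ - a) • cross em d))
    {Y : ℝ → EuclideanSpace ℝ (Fin 3)} (hY : ContDiff ℝ 2 Y) (hoff : ∀ τ, τ ∉ Icc a b → Y τ = 0) :
    (∫ σ in a..b, ⟪φ σ, cst • (m σ • cross d (Y σ) - ∫ τ in Icc a b, k (τ - σ) • cross d (Y τ))
        + (1 / 2 : ℝ) • Y σ - α • cross e (Y σ) - w σ • deriv Y σ⟫)
      + ⟪ep, cst • (m b • cross d (Y b) - ∫ τ in Icc a b, k (τ - b) • cross d (Y τ))
        + (1 / 2 : ℝ) • Y b - α • cross e (Y b) - w b • deriv Y b⟫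
      + ⟪em, cst • (m a • cross d (Y a) - ∫ τ in Icc a b, k (τ - a) • cross d (Y τ))
        + (1 / 2 : ℝ) • Y a - α • cross e (Y a) - w a • deriv Y a⟫ = 0 := by
  have hab : a < b := hac.trans hcb
  have hwc : Continuous w := continuous_iff_continuousAt.2 fun σ => (hw σ).continuousAt
  have hYc : Continuous Y := hY.continuous
  have hY'c : Continuous (deriv Y) := hY.continuous_deriv (by norm_num)
  have hYd : ∀ σ, HasDerivAt Y (deriv Y σ) σ := fun σ => (hY.differentiable (by norm_num) σ).hasDerivAt
  obtain ⟨hYa, hY'a, hYb, hY'b⟩ := clamped_endpoints hY hoff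
  have hrot : ∀ x y : EuclideanSpace ℝ (Fin 3), ⟪x, cross e y⟫ = -⟪cross e x, y⟫ := fun x y => by
    simp only [cross, cross_apply, PiLp.inner_apply, RCLike.inner_apply, conj_trivial, Fin.sum_univ_three,
      Matrix.cons_val_zero, Matrix.cons_val_one, Matrix.cons_val_two, Matrix.head_cons, Matrix.tail_cons]
    ring
  -- atoms = pure leaks
  rw [model_forward_at_clamped (Y' := deriv Y) hYb hY'b, model_forward_at_clamped (Y' := deriv Y) hYa hY'a]
  -- continuity of the building blocks
  have hcrossY : Continuous fun τ => cross d (Y τ) := by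
    have : Continuous fun τ => crossCLM d (Y τ) := (crossCLM.continuous₂).comp₂ continuous_const hYc
    simpa only [crossCLM_apply] using this
  have hcrossφ : Continuous fun σ => cross (φ σ) d := by
    have : Continuous fun σ => crossCLM (φ σ) d := (crossCLM.continuous₂).comp₂ hφc continuous_const
    simpa only [crossCLM_apply] using this
  have hce : Continuous fun σ => cross e (φ σ) := by
    have : Continuous fun σ => crossCLM e (φ σ) := (crossCLM.continuous₂).comp₂ continuous_const hφc
    simpa only [crossCLM_apply] using this
  have hc1 : Continuous fun σ => cst • (m σ • cross (φ σ) d) + (1 / 2 : ℝ) • φ σ + α • cross e (φ σ) :=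
    (((hm.smul hcrossφ).const_smul cst).add (hφc.const_smul (1 / 2 : ℝ))).add (hce.const_smul α)
  have hNY : Continuous fun σ => ∫ τ in Icc a b, k (τ - σ) • cross d (Y τ) := by
    have hj : Continuous (Function.uncurry fun σ τ => k (τ - σ) • cross d (Y τ)) :=
      (hk.comp (continuous_snd.sub continuous_fst)).smul (hcrossY.comp continuous_snd)
    exact continuous_parametric_integral_of_continuous hj isCompact_Icc
  have hNφ : Continuous fun τ => ∫ σ in Icc a b, k (σ - τ) • cross (φ σ) d := by
    have hj : Continuous (Function.uncurry fun τ σ => k (σ - τ) • cross (φ σ) d) :=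
      (hk.comp (continuous_snd.sub continuous_fst)).smul (hcrossφ.comp continuous_snd)
    exact continuous_parametric_integral_of_continuous hj isCompact_Icc
  have hedge : Continuous fun σ => cst • (k (σ - b) • cross ep d + k (σ - a) • cross em d) :=
    (((hk.comp (continuous_id.sub continuous_const)).smul continuous_const).add
      ((hk.comp (continuous_id.sub continuous_const)).smul continuous_const)).const_smul cst
  -- the transport coefficient `w φ′`, read off the equation as a continuous function
  set ψ : ℝ → EuclideanSpace ℝ (Fin 3) := fun σ =>
    cst • (k (σ - b) • cross ep d + k (σ - a) • cross em d)
      - ((cst • (m σ • cross (φ σ) d) + (1 / 2 : ℝ) • φ σ + α • cross e (φ σ))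
        - cst • (∫ τ in Icc a b, k (τ - σ) • cross (φ τ) d) + w' σ • φ σ) with hψdef
  have hψc : Continuous ψ := hedge.sub (((hc1.sub (hNφ.const_smul cst))).add (hw'c.smul hφc))
  have hψ : ∀ σ ∈ Ioo a b, σ ≠ c → w σ • φ' σ = ψ σ := by
    intro σ hσ hσc
    have h := hsol σ hσ hσc
    simp only [hψdef]
    rw [← h, smul_sub]
    abel
  -- Step 1: split the interval integral into local algebraic part, nonlocal part and transport part
  have hsplit : ∀ σ, ⟪φ σ, cst • (m σ • cross d (Y σ) - ∫ τ in Icc a b, k (τ - σ) • cross d (Y τ))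
        + (1 / 2 : ℝ) • Y σ - α • cross e (Y σ) - w σ • deriv Y σ⟫
      = ⟪cst • (m σ • cross (φ σ) d) + (1 / 2 : ℝ) • φ σ + α • cross e (φ σ), Y σ⟫
        - cst * ⟪φ σ, ∫ τ in Icc a b, k (τ - σ) • cross d (Y τ)⟫ + ⟪φ σ, -(w σ • deriv Y σ)⟫ := by
    intro σ
    simp only [inner_add_right, inner_sub_right, inner_smul_right, inner_add_left, inner_smul_left, conj_trivial, inner_neg_right,
      inner_cross_transpose (φ σ) d (Y σ), hrot (φ σ) (Y σ)]
    ring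
  have hI : ∫ σ in a..b, ⟪φ σ, cst • (m σ • cross d (Y σ) - ∫ τ in Icc a b, k (τ - σ) • cross d (Y τ))
        + (1 / 2 : ℝ) • Y σ - α • cross e (Y σ) - w σ • deriv Y σ⟫
      = (∫ σ in a..b, ⟪cst • (m σ • cross (φ σ) d) + (1 / 2 : ℝ) • φ σ + α • cross e (φ σ), Y σ⟫)
        - cst * (∫ σ in a..b, ⟪φ σ, ∫ τ in Icc a b, k (τ - σ) • cross d (Y τ)⟫)
        + ∫ σ in a..b, ⟪φ σ, -(w σ • deriv Y σ)⟫ := by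
    have hi1 : IntervalIntegrable (fun σ => ⟪cst • (m σ • cross (φ σ) d) + (1 / 2 : ℝ) • φ σ + α • cross e (φ σ), Y σ⟫) volume a b :=
      (hc1.inner hYc).intervalIntegrable _ _
    have hi2 : IntervalIntegrable (fun σ => cst * ⟪φ σ, ∫ τ in Icc a b, k (τ - σ) • cross d (Y τ)⟫) volume a b :=
      (continuous_const.mul (hφc.inner hNY)).intervalIntegrable _ _
    have hi3 : IntervalIntegrable (fun σ => ⟪φ σ, -(w σ • deriv Y σ)⟫) volume a b :=
      (hφc.inner (hwc.smul hY'c).neg).intervalIntegrable _ _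
    rw [intervalIntegral.integral_congr (fun σ _ => hsplit σ), intervalIntegral.integral_add (hi1.sub hi2) hi3,
      intervalIntegral.integral_sub hi1 hi2, intervalIntegral.integral_const_mul]
  -- Step 2: nonlocal part by Fubini, transport part by parts (punctured)
  have hN : ∫ σ in a..b, ⟪φ σ, ∫ τ in Icc a b, k (τ - σ) • cross d (Y τ)⟫
      = ∫ τ in a..b, ⟪∫ σ in Icc a b, k (σ - τ) • cross (φ σ) d, Y τ⟫ := by
    rw [integral_of_le hab.le, integral_of_le hab.le, ← integral_Icc_eq_integral_Ioc, ← integral_Icc_eq_integral_Ioc]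
    exact setIntegral_inner_nonlocal_swap hk hkev hφc hYc d
  have hT := integral_transport_pairing_punctured hac hcb hw hw'c hφc hφ hψc hψ hYd hY'c hYa hYb
  rw [hI, hN, hT]
  -- Step 3: the atoms as integrals against `Y`
  have hatom : ∀ (x : ℝ) (ee : EuclideanSpace ℝ (Fin 3)),
      ⟪ee, -(cst • ∫ τ in Icc a b, k (τ - x) • cross d (Y τ))⟫ = -(cst * ∫ τ in a..b, ⟪k (τ - x) • cross ee d, Y τ⟫) := by
    intro x ee
    have hint : IntegrableOn (fun τ => k (τ - x) • cross d (Y τ)) (Icc a b) :=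
      ((hk.comp (continuous_id.sub continuous_const)).smul hcrossY).continuousOn.integrableOn_compact isCompact_Icc
    rw [inner_neg_right, inner_smul_right, ← integral_inner hint ee, integral_of_le hab.le, ← integral_Icc_eq_integral_Ioc]
    congr 2
    refine integral_congr_ae (Eventually.of_forall fun τ => ?_)
    simp only [inner_smul_right, inner_smul_left, conj_trivial, inner_cross_transpose]
  rw [hatom b ep, hatom a em]
  -- Step 4: everything is `∫ ⟪G τ, Y τ⟫` with `G = 0` by the definition of `ψ`
  have hi1 : IntervalIntegrable (fun σ => ⟪cst • (m σ • cross (φ σ) d) + (1 / 2 : ℝ) • φ σ + α • cross e (φ σ), Y σ⟫) volume a b :=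
    (hc1.inner hYc).intervalIntegrable _ _
  have hi2 : IntervalIntegrable (fun τ => ⟪∫ σ in Icc a b, k (σ - τ) • cross (φ σ) d, Y τ⟫) volume a b :=
    (hNφ.inner hYc).intervalIntegrable _ _
  have hi3 : IntervalIntegrable (fun σ => ⟪w' σ • φ σ + ψ σ, Y σ⟫) volume a b :=
    (((hw'c.smul hφc).add hψc).inner hYc).intervalIntegrable _ _
  have hi4 : ∀ (x : ℝ) (ee : EuclideanSpace ℝ (Fin 3)), IntervalIntegrable (fun τ => ⟪k (τ - x) • cross ee d, Y τ⟫) volume a b :=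
    fun x ee => (((hk.comp (continuous_id.sub continuous_const)).smul continuous_const).inner hYc).intervalIntegrable _ _
  have hG : ∀ τ, ⟪cst • (m τ • cross (φ τ) d) + (1 / 2 : ℝ) • φ τ + α • cross e (φ τ), Y τ⟫
      - cst * ⟪∫ σ in Icc a b, k (σ - τ) • cross (φ σ) d, Y τ⟫ + ⟪w' τ • φ τ + ψ τ, Y τ⟫
      - cst * ⟪k (τ - b) • cross ep d, Y τ⟫ - cst * ⟪k (τ - a) • cross em d, Y τ⟫ = 0 := by
    intro τ
    have hvec : cst • (m τ • cross (φ τ) d) + (1 / 2 : ℝ) • φ τ + α • cross e (φ τ)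
        - cst • (∫ σ in Icc a b, k (σ - τ) • cross (φ σ) d) + (w' τ • φ τ + ψ τ)
        - cst • (k (τ - b) • cross ep d) - cst • (k (τ - a) • cross em d) = 0 := by
      simp only [hψdef, smul_add]
      abel
    have h'' := congrArg (fun v => ⟪v, Y τ⟫) hvec
    simp only [inner_zero_left, inner_sub_left, inner_add_left, inner_smul_left, conj_trivial] at h''
    simp only [inner_add_left, inner_smul_left, conj_trivial]
    linear_combination h''
  have hzero : ∫ τ in a..b, (⟪cst • (m τ • cross (φ τ) d) + (1 / 2 : ℝ) • φ τ + α • cross e (φ τ), Y τ⟫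
      - cst * ⟪∫ σ in Icc a b, k (σ - τ) • cross (φ σ) d, Y τ⟫ + ⟪w' τ • φ τ + ψ τ, Y τ⟫
      - cst * ⟪k (τ - b) • cross ep d, Y τ⟫ - cst * ⟪k (τ - a) • cross em d, Y τ⟫) = 0 := by
    rw [← intervalIntegral.integral_zero (a := a) (b := b)]
    exact intervalIntegral.integral_congr fun τ _ => hG τ
  rw [intervalIntegral.integral_sub ((((hi1.sub (hi2.const_mul cst)).add hi3).sub ((hi4 b ep).const_mul cst)))
      ((hi4 a em).const_mul cst), intervalIntegral.integral_sub (((hi1.sub (hi2.const_mul cst)).add hi3))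
      ((hi4 b ep).const_mul cst), intervalIntegral.integral_add (hi1.sub (hi2.const_mul cst)) hi3,
      intervalIntegral.integral_sub hi1 (hi2.const_mul cst), intervalIntegral.integral_const_mul,
      intervalIntegral.integral_const_mul, intervalIntegral.integral_const_mul] at hzero
  linarith

/-! ## §3 The annihilating edge measure exists for every pair of atoms -/

/-- **THE EDGE FAMILY OF THE MODEL COKERNEL EXISTS.**  Ball `[a, b] ∋ c` inside `(a₀, b₀)` on which the `C¹` slip (`w(c) = 0`) opens at least linearly
on both sides and has `w′ ≥ −1 + 2ε` on `[a, b]`; even continuous kernel, continuous weight.  Then for EVERY pair of atoms `e₊, e₋` there is a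
continuous density `φ` such that the edge measure `e₊δ_b + e₋δ_a + φ dσ` annihilates the forward model operator on all `C²` fields vanishing off
`[a, b]` (existence p837535 + punctured annihilation). [folklore] -/
theorem exists_annihilating_edgeMeasure {a₀ a c b b₀ κ₁ ε cst α : ℝ} {k m w w' : ℝ → ℝ} {d e : EuclideanSpace ℝ (Fin 3)}
    (h₀ : a₀ < a) (hac : a < c) (hcb : c < b) (h₁ : b < b₀) (hκ₁ : 0 < κ₁) (hε : 0 < ε)
    (hk : Continuous k) (hkev : ∀ s, k (-s) = k s)
    (hw : ∀ s, HasDerivAt w (w' s) s) (hw'c : Continuous w') (hm : Continuous m) (hwc0 : w c = 0)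
    (hwR : ∀ s ∈ Icc c b₀, κ₁ * (s - c) ≤ w s) (hwL : ∀ s ∈ Icc a₀ c, κ₁ * (c - s) ≤ -w s)
    (hgrowth : ∀ σ ∈ Icc a b, -1 + 2 * ε ≤ w' σ) (ep em : EuclideanSpace ℝ (Fin 3)) :
    ∃ φ : ℝ → EuclideanSpace ℝ (Fin 3), Continuous φ ∧
      ∀ (Y : ℝ → EuclideanSpace ℝ (Fin 3)), ContDiff ℝ 2 Y → (∀ τ, τ ∉ Icc a b → Y τ = 0) →
        (∫ σ in a..b, ⟪φ σ, cst • (m σ • cross d (Y σ) - ∫ τ in Icc a b, k (τ - σ) • cross d (Y τ))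
            + (1 / 2 : ℝ) • Y σ - α • cross e (Y σ) - w σ • deriv Y σ⟫)
          + ⟪ep, cst • (m b • cross d (Y b) - ∫ τ in Icc a b, k (τ - b) • cross d (Y τ))
            + (1 / 2 : ℝ) • Y b - α • cross e (Y b) - w b • deriv Y b⟫
          + ⟪em, cst • (m a • cross d (Y a) - ∫ τ in Icc a b, k (τ - a) • cross d (Y τ))
            + (1 / 2 : ℝ) • Y a - α • cross e (Y a) - w a • deriv Y a⟫ = 0 := by
  have hab : a ≤ b := (hac.trans hcb).le
  -- the edge source and the punctured solution it drives
  have hg : Continuous fun σ => cst • (k (σ - b) • cross ep d + k (σ - a) • cross em d) :=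
    (((hk.comp (continuous_id.sub continuous_const)).smul continuous_const).add
      ((hk.comp (continuous_id.sub continuous_const)).smul continuous_const)).const_smul cst
  obtain ⟨ψ₀, ψ₀', hψc, hψd, -, hψeq⟩ := exists_model_adjoint_punctured_solution (α := α) (cst := cst) (d := d) (e := e) h₀ hac hcb h₁
    hκ₁ hε hk hkev hw hw'c hm hwc0 hwR hwL hgrowth hg
  -- constant extension outside the ball: a globally continuous density agreeing with `ψ₀` on `[a, b]`
  set φ : ℝ → EuclideanSpace ℝ (Fin 3) := IccExtend hab (fun x : Icc a b => ψ₀ x) with hφdef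
  have hφc : Continuous φ := (continuousOn_iff_continuous_restrict.1 hψc).Icc_extend'
  have hφeq : ∀ σ ∈ Icc a b, φ σ = ψ₀ σ := fun σ hσ => by
    simp only [hφdef, Set.IccExtend_of_mem hab _ hσ]
  have hev : ∀ σ ∈ Ioo a b, φ =ᶠ[𝓝 σ] ψ₀ := fun σ hσ => by
    filter_upwards [Ioo_mem_nhds hσ.1 hσ.2] with x hx using hφeq x ⟨hx.1.le, hx.2.le⟩
  have hφd : ∀ σ ∈ Ioo a b, σ ≠ c → HasDerivAt φ (ψ₀' σ) σ := fun σ hσ hσc =>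
    (hψd σ ⟨hσ.1.le, hσ.2.le⟩ hσc).congr_of_eventuallyEq (hev σ hσ)
  have hint : ∀ σ, ∫ τ in Icc a b, k (τ - σ) • cross (φ τ) d = ∫ τ in Icc a b, k (τ - σ) • cross (ψ₀ τ) d := fun σ =>
    setIntegral_congr_fun measurableSet_Icc fun τ hτ => by rw [hφeq τ hτ]
  have hsol : ∀ σ ∈ Ioo a b, σ ≠ c →
      cst • (m σ • cross (φ σ) d - ∫ τ in Icc a b, k (τ - σ) • cross (φ τ) d)
        + (1 / 2 : ℝ) • φ σ + α • cross e (φ σ) + w' σ • φ σ + w σ • ψ₀' σ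
        = cst • (k (σ - b) • cross ep d + k (σ - a) • cross em d) := by
    intro σ hσ hσc
    rw [hint σ, hφeq σ ⟨hσ.1.le, hσ.2.le⟩]
    exact hψeq σ ⟨hσ.1.le, hσ.2.le⟩ hσc
  exact ⟨φ, hφc, fun Y hY hoff => edgeMeasure_annihilates_punctured hac hcb hk hkev hm hw hw'c hφc hφd hsol hY hoff⟩

end Summit.NavierStokesRegularity.NavierStokesRegularity.Theorems.Clause13REdgeMeasurePunctured

end
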